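import Mathlib.Analysis.InnerProductSpace.PiL2

/-!
# The path-variance identity in `ℝ³`
(stub `tube_pathVariance` of line `mtp-prestress-split-ergodic-frame`, crux `LayeredLawsSelectHcp`,
stmt-AtomisticToContinuum-9226)

For finitely many vectors `v₀, …, v_{n-1}` of a real inner product space,
`‖∑ vᵢ‖² = n ∑ ‖vᵢ‖² − ∑_{i<j} ‖vᵢ − vⱼ‖²`: expanding
`‖vᵢ − vⱼ‖² = ‖vᵢ‖² + ‖vⱼ‖² − 2⟪vᵢ, vⱼ⟫` and summing over ALL ordered pairs gives
`∑ᵢ ∑ⱼ ‖vᵢ − vⱼ‖² = 2n ∑ ‖vᵢ‖² − 2‖∑ vᵢ‖²` (`pathVar_sum_sum_norm_sub_sq`), and the ordered-pair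
sum is twice the sum over `i < j` because the summand is symmetric and vanishes on the diagonal
(`pathVar_halving`). The far field of the rigidity certificate uses it (with `n` the length of a
straight label path and `vᵢ` its bond vectors) to control the far squared length `‖∑ vᵢ‖²` by
`n ∑ ‖vᵢ‖²` minus a nonnegative shortening. All `[folklore]`.
-/

noncomputable section

namespace Summit.AtomisticToContinuum.Crystallization.Theorems.PalmUnimodularRigidity.LayeredLawsSelectHcp

open Finset

/-- `‖∑ᵢ vᵢ‖² = ∑ᵢ ∑ⱼ ⟪vᵢ, vⱼ⟫`. [folklore] -/
theorem pathVar_norm_sum_sq {ι F : Type*} [NormedAddCommGroup F] [InnerProductSpace ℝ F]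
    (s : Finset ι) (v : ι → F) :
    ‖∑ i ∈ s, v i‖ ^ 2 = ∑ i ∈ s, ∑ j ∈ s, inner ℝ (v i) (v j) := by
  rw [← real_inner_self_eq_norm_sq, sum_inner]
  refine sum_congr rfl fun i _ => ?_
  rw [inner_sum]

/-- The symmetric form: `∑ᵢ ∑ⱼ ‖vᵢ − vⱼ‖² = 2 n ∑ ‖vᵢ‖² − 2 ‖∑ vᵢ‖²` (`n = #s`). [folklore] -/
theorem pathVar_sum_sum_norm_sub_sq {ι F : Type*} [NormedAddCommGroup F] [InnerProductSpace ℝ F]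
    (s : Finset ι) (v : ι → F) :
    ∑ i ∈ s, ∑ j ∈ s, ‖v i - v j‖ ^ 2 =
      2 * s.card * ∑ i ∈ s, ‖v i‖ ^ 2 - 2 * ‖∑ i ∈ s, v i‖ ^ 2 := by
  have h : ∀ i j, ‖v i - v j‖ ^ 2 = ‖v i‖ ^ 2 + ‖v j‖ ^ 2 - 2 * inner ℝ (v i) (v j) := by
    intro i j
    rw [norm_sub_sq_real]
    ring
  simp_rw [h, sum_sub_distrib, sum_add_distrib, sum_const, nsmul_eq_mul, ← mul_sum,
    pathVar_norm_sum_sq]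
  ring

/-- Halving: the sum over `i < j` is half the sum over all ordered pairs, the summand being
symmetric and zero on the diagonal. [folklore] -/
theorem pathVar_halving {F : Type*} [NormedAddCommGroup F] (n : ℕ) (v : Fin n → F) :
    2 * (∑ i, ∑ j, if i < j then ‖v i - v j‖ ^ 2 else 0) = ∑ i, ∑ j, ‖v i - v j‖ ^ 2 := by
  have hsymm : (∑ i, ∑ j, if i < j then ‖v i - v j‖ ^ 2 else 0) =
      ∑ i, ∑ j, if j < i then ‖v i - v j‖ ^ 2 else (0 : ℝ) := by
    rw [sum_comm]
    refine sum_congr rfl fun i _ => sum_congr rfl fun j _ => ?_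
    rw [norm_sub_rev]
  have hpt : ∀ i j : Fin n, ((if i < j then ‖v i - v j‖ ^ 2 else 0) +
      if j < i then ‖v i - v j‖ ^ 2 else (0 : ℝ)) = ‖v i - v j‖ ^ 2 := by
    intro i j
    rcases lt_trichotomy i j with hij | rfl | hji
    · simp [hij, not_lt.2 hij.le]
    · simp
    · simp [hji, not_lt.2 hji.le]
  rw [two_mul]
  nth_rewrite 2 [hsymm]
  rw [← sum_add_distrib]
  refine sum_congr rfl fun i _ => ?_
  rw [← sum_add_distrib]
  exact sum_congr rfl fun j _ => hpt i j

/-- **Path variance (stub `tube_pathVariance`).** For `v : Fin n → ℝ³`,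
`‖∑ vᵢ‖² = n ∑ ‖vᵢ‖² − ∑_{i<j} ‖vᵢ − vⱼ‖²`. [folklore] -/
theorem tube_pathVariance : ∀ (n : ℕ) (v : Fin n → EuclideanSpace ℝ (Fin 3)),
    ‖∑ i, v i‖ ^ 2 = n * ∑ i, ‖v i‖ ^ 2 - ∑ i, ∑ j, if i < j then ‖v i - v j‖ ^ 2 else 0 := by
  intro n v
  have h2 := pathVar_halving n v
  rw [pathVar_sum_sum_norm_sub_sq, card_univ, Fintype.card_fin] at h2
  linarith

end Summit.AtomisticToContinuum.Crystallization.Theorems.PalmUnimodularRigidity.LayeredLawsSelectHcp
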